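import Summits.CriticalPhenomena.PercolationContinuityZ3.Theorems.PercNearOneGluingNoHeavyLowerTailFrontierDecRowsEdgeInduction
import HarnessLib

/-!
# The MEAN-CHORD induction schema for Sahi's cubic `E₃(A,B,C)` under bond percolation

Support file for the Sahi programme (`--supports stmt-CriticalPhenomena-4575`, prover prim-sahi-p2 gen 14).  No definitions, no named
facts, no sorries; standard axioms.  Memo `run/shared/lean/prim/prim-sahi/FROM-prim-sahi-p2-gen14-MEAN-CHORD.md`, `prim-sahi-p2/PROOF-E3.md` §25.

Along one pair `e` of weight `p = w e`, Sahi's cubic `T(w) = E₃(A,B,C)` under `prodBernoulli w` is a Bernstein cubic in `p`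
(`EdgeInduction.sahiE3_oneBond`), and `T(w) − [(1−p)·T(w[e↦0]) + p·T(w[e↦1])] = p(1−p)·Λ_w(e)` measures how far `T` lies above the CHORD
through its two end values.  The per-pair chord property `Λ_w(e) ≥ 0` (prim-sahi-p2 gen 4's `(S∅)`) is FALSE from eight vertices on (bypass
family, gen 5 / ttrl2), but no violation is known of the EDGE-AVERAGED ("mean-chord") inequality
  `(MC)   #F(w) · T(w) ≥ Σ_{e ∈ F(w)} [(1 − w e)·T(w[e↦0]) + (w e)·T(w[e↦1])]`,   `F(w)` = the pairs with `0 < w e < 1`,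
equivalently `Σ_e (w e)(1 − w e) Λ_w(e) ≥ 0`, equivalently (gen 14) `d/ds G(s) ≤ 0` at `s = 0` for the interpolation `G` between three
independent copies (`s = 0`, value `6T`) and three identical copies (`s = 1`, value `0`) in which every pair is shared by the copies
independently with probability `s`.  For the increasing star, `(MC)` is moreover three-copy FIBRE-POSITIVE on `K₄` and `K₅` (its
tensor-Bernstein coefficients `S_MC(k) = Σ_{e: k_e=1}[S(k) − 2S(k^{e→0}) − S(k^{e→3})] + Σ_{e: k_e=2}[S(k) − S(k^{e→0}) − 2S(k^{e→3})]`, `S` the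
ISTAR fibre array, are all `≥ 0`: an exact certificate of `(MC)` for every weighted graph on `≤ 5` vertices), and no violation is known on larger
graphs (memo: census, bypass family, dense graphs near `p = 1`, monotonicity of `G`).

**Theorems** (this file).  `sahiE3_nonneg_of_existsChord`: if for every weight with a fractional pair SOME fractional pair satisfies the
chord inequality `(1−w e)·T(w[e↦0]) + (w e)·T(w[e↦1]) ≤ T(w)` (given `E₃ ≥ 0` for all weights with fewer fractional pairs), then `E₃(A,B,C) ≥ 0`
for every weight — one good pair per weight suffices.  `sahiE3_nonneg_of_meanChord`: if `(MC)` holds for every weight `w` with at least one fractional pair — and in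
verifying it one may already assume `E₃(A,B,C) ≥ 0` for every weight with fewer fractional pairs — then `E₃(A,B,C) ≥ 0` under
`prodBernoulli w` for EVERY `w`.  Proof: induction on `#F(w)`; each end value `T(w[e↦0])`, `T(w[e↦1])` has fewer fractional pairs, so the
right-hand side of `(MC)` is nonnegative, hence so is `#F(w)·T(w)`; with no fractional pair the measure is a point mass and `E₃ = 0`
(`EdgeInduction.sahiE3_eq_zero_of_zeroOne`).  The statement is for ARBITRARY events `A, B, C`; for the increasing star
(`A,B,C = {s↔b},{s↔c},{s↔y}`) these are `incStar_nonneg_of_existsChord` / `incStar_nonneg_of_meanChord` (induction hypothesis over all markings).  Nothing here asserts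
`(MC)` or the ∃-chord property; they are hypotheses.
-/

noncomputable section

namespace Summit.CriticalPhenomena.PercolationContinuityZ3.Theorems

namespace EdgeInduction

open MeasureTheory Literature.Probability.Percolation Literature.Probability.LatticeModels
open scoped Classical

variable {n : ℕ}

/-- The chord value of `E₃(A,B,C)` at the pair `e`: `(1 − w e)·E₃(w[e↦0]) + (w e)·E₃(w[e↦1])`. [this work] -/
theorem chord_nonneg_of_ends (w : Sym2 (Fin n) → unitInterval) (e : Sym2 (Fin n)) (A B C : Set (BondConfig (Fin n)))
    (h0 : 0 ≤ sahiE3 (prodBernoulli (Function.update w e 0)) A B C)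
    (h1 : 0 ≤ sahiE3 (prodBernoulli (Function.update w e 1)) A B C) :
    0 ≤ (1 - (w e : ℝ)) * sahiE3 (prodBernoulli (Function.update w e 0)) A B C
        + (w e : ℝ) * sahiE3 (prodBernoulli (Function.update w e 1)) A B C := by
  have hp0 : (0 : ℝ) ≤ w e := (w e).2.1
  have hp1 : (w e : ℝ) ≤ 1 := (w e).2.2
  have hq : (0 : ℝ) ≤ 1 - w e := sub_nonneg.2 hp1
  positivity

/-- **THE ∃-CHORD INDUCTION SCHEMA** (weakest form).  Suppose that for every weight `w` with a fractional pair — given `E₃(A,B,C) ≥ 0`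
for every weight with strictly fewer fractional pairs — SOME fractional pair `e` satisfies the chord inequality
`(1 − w e)·E₃(w[e↦0]) + (w e)·E₃(w[e↦1]) ≤ E₃(w)` (i.e. `Λ_w(e) ≥ 0` for at least one `e`).  Then `E₃(A,B,C) ≥ 0` under `prodBernoulli w`
for every `w`.  (The per-pair chord property for ALL pairs is false; one good pair per weight suffices for the induction.) [this work] -/
theorem sahiE3_nonneg_of_existsChord (A B C : Set (BondConfig (Fin n)))
    (h : ∀ w : Sym2 (Fin n) → unitInterval, (fracEdges w).Nonempty →
      (∀ w' : Sym2 (Fin n) → unitInterval, (fracEdges w').card < (fracEdges w).card → 0 ≤ sahiE3 (prodBernoulli w') A B C) →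
      ∃ e ∈ fracEdges w, (1 - (w e : ℝ)) * sahiE3 (prodBernoulli (Function.update w e 0)) A B C
          + (w e : ℝ) * sahiE3 (prodBernoulli (Function.update w e 1)) A B C ≤ sahiE3 (prodBernoulli w) A B C) :
    ∀ w : Sym2 (Fin n) → unitInterval, 0 ≤ sahiE3 (prodBernoulli w) A B C := by
  suffices H : ∀ (k : ℕ) (w : Sym2 (Fin n) → unitInterval), (fracEdges w).card ≤ k → 0 ≤ sahiE3 (prodBernoulli w) A B C from
    fun w => H _ w le_rfl
  intro k
  induction k with
  | zero =>
      intro w hk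
      have hw : ∀ e, w e = 0 ∨ w e = 1 := fun e =>
        eq_zero_or_one_of_not_mem_fracEdges (by
          intro he
          have : 0 < (fracEdges w).card := Finset.card_pos.2 ⟨e, he⟩
          omega)
      rw [sahiE3_eq_zero_of_zeroOne w hw]
  | succ k ih =>
      intro w hk
      by_cases hempty : fracEdges w = ∅
      · have hw : ∀ e, w e = 0 ∨ w e = 1 := fun e => eq_zero_or_one_of_not_mem_fracEdges (by rw [hempty]; simp)
        rw [sahiE3_eq_zero_of_zeroOne w hw]
      · have hne : (fracEdges w).Nonempty := Finset.nonempty_iff_ne_empty.2 hempty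
        have hIH : ∀ w' : Sym2 (Fin n) → unitInterval, (fracEdges w').card < (fracEdges w).card →
            0 ≤ sahiE3 (prodBernoulli w') A B C := fun w' hw' => ih w' (by omega)
        obtain ⟨e, he, hle⟩ := h w hne hIH
        refine le_trans (chord_nonneg_of_ends w e A B C ?_ ?_) hle
        · refine hIH _ ?_
          have h1 := Finset.card_le_card (fracEdges_update_subset w e 0 (Or.inl rfl))
          rw [Finset.card_erase_of_mem he] at h1
          have hpos := Finset.card_pos.2 hne
          omega
        · refine hIH _ ?_
          have h1 := Finset.card_le_card (fracEdges_update_subset w e 1 (Or.inr rfl))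
          rw [Finset.card_erase_of_mem he] at h1
          have hpos := Finset.card_pos.2 hne
          omega

/-- An average bound yields a member below the average: if `Σ_{e∈F} f e ≤ #F · t` and `F` is nonempty then `f e ≤ t` for some `e ∈ F`. [folklore] -/
theorem exists_le_of_sum_le_card_mul {ι : Type*} (F : Finset ι) (hF : F.Nonempty) (f : ι → ℝ) (t : ℝ)
    (h : ∑ e ∈ F, f e ≤ (F.card : ℝ) * t) : ∃ e ∈ F, f e ≤ t := by
  by_contra hcon
  push Not at hcon
  have hlt : (F.card : ℝ) * t < ∑ e ∈ F, f e := by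
    calc (F.card : ℝ) * t = ∑ e ∈ F, t := by rw [Finset.sum_const, nsmul_eq_mul]
      _ < ∑ e ∈ F, f e := Finset.sum_lt_sum_of_nonempty hF fun e he => hcon e he
  linarith

/-- **THE MEAN-CHORD INDUCTION SCHEMA.**  Suppose that for every weight `w` with a fractional pair, GIVEN `E₃(A,B,C) ≥ 0` for every weight
with strictly fewer fractional pairs, the edge-averaged chord inequality
`#F(w)·E₃(w) ≥ Σ_{e∈F(w)} [(1 − w e)·E₃(w[e↦0]) + (w e)·E₃(w[e↦1])]` holds.  Then `E₃(A,B,C) ≥ 0` under `prodBernoulli w` for every `w`.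
[this work] -/
theorem sahiE3_nonneg_of_meanChord (A B C : Set (BondConfig (Fin n)))
    (h : ∀ w : Sym2 (Fin n) → unitInterval, (fracEdges w).Nonempty →
      (∀ w' : Sym2 (Fin n) → unitInterval, (fracEdges w').card < (fracEdges w).card → 0 ≤ sahiE3 (prodBernoulli w') A B C) →
      ∑ e ∈ fracEdges w, ((1 - (w e : ℝ)) * sahiE3 (prodBernoulli (Function.update w e 0)) A B C
          + (w e : ℝ) * sahiE3 (prodBernoulli (Function.update w e 1)) A B C)
        ≤ ((fracEdges w).card : ℝ) * sahiE3 (prodBernoulli w) A B C) :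
    ∀ w : Sym2 (Fin n) → unitInterval, 0 ≤ sahiE3 (prodBernoulli w) A B C :=
  sahiE3_nonneg_of_existsChord A B C fun w hne hIH =>
    exists_le_of_sum_le_card_mul (fracEdges w) hne _ _ (h w hne hIH)

end EdgeInduction

namespace IncStar

open MeasureTheory Literature.Probability.Percolation Literature.Probability.LatticeModels EdgeInduction
open scoped Classical

variable {n : ℕ}

/-- **The increasing star follows from the ∃-chord inequality**: if for every weight `w` on `Fin n` with a fractional pair and all markings
`s b c y` — given the increasing star for every weight with fewer fractional pairs and EVERY marking — some fractional pair `e` satisfies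
`(1 − w e)·E₃(w[e↦0]) + (w e)·E₃(w[e↦1]) ≤ E₃(w)` for `E₃({s↔b},{s↔c},{s↔y})`, then the increasing star holds on every finite weighted
graph on `Fin n`. [this work] -/
theorem incStar_nonneg_of_existsChord
    (h : ∀ (w : Sym2 (Fin n) → unitInterval) (s b c y : Fin n), (fracEdges w).Nonempty →
      (∀ (w' : Sym2 (Fin n) → unitInterval) (s' b' c' y' : Fin n), (fracEdges w').card < (fracEdges w).card →
          0 ≤ sahiE3 (prodBernoulli w') (openConn s' b') (openConn s' c') (openConn s' y')) →
      ∃ e ∈ fracEdges w, (1 - (w e : ℝ)) * sahiE3 (prodBernoulli (Function.update w e 0)) (openConn s b) (openConn s c) (openConn s y)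
          + (w e : ℝ) * sahiE3 (prodBernoulli (Function.update w e 1)) (openConn s b) (openConn s c) (openConn s y)
        ≤ sahiE3 (prodBernoulli w) (openConn s b) (openConn s c) (openConn s y)) :
    ∀ (w : Sym2 (Fin n) → unitInterval) (s b c y : Fin n),
      0 ≤ sahiE3 (prodBernoulli w) (openConn s b) (openConn s c) (openConn s y) := by
  suffices H : ∀ (k : ℕ) (w : Sym2 (Fin n) → unitInterval), (fracEdges w).card ≤ k →
      ∀ s b c y : Fin n, 0 ≤ sahiE3 (prodBernoulli w) (openConn s b) (openConn s c) (openConn s y) from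
    fun w s b c y => H _ w le_rfl s b c y
  intro k
  induction k with
  | zero =>
      intro w hk s b c y
      have hw : ∀ e, w e = 0 ∨ w e = 1 := fun e =>
        eq_zero_or_one_of_not_mem_fracEdges (by
          intro he
          have : 0 < (fracEdges w).card := Finset.card_pos.2 ⟨e, he⟩
          omega)
      rw [sahiE3_eq_zero_of_zeroOne w hw]
  | succ k ih =>
      intro w hk s b c y
      by_cases hempty : fracEdges w = ∅
      · have hw : ∀ e, w e = 0 ∨ w e = 1 := fun e => eq_zero_or_one_of_not_mem_fracEdges (by rw [hempty]; simp)
        rw [sahiE3_eq_zero_of_zeroOne w hw]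
      · have hne : (fracEdges w).Nonempty := Finset.nonempty_iff_ne_empty.2 hempty
        have hIH : ∀ (w' : Sym2 (Fin n) → unitInterval) (s' b' c' y' : Fin n), (fracEdges w').card < (fracEdges w).card →
            0 ≤ sahiE3 (prodBernoulli w') (openConn s' b') (openConn s' c') (openConn s' y') :=
          fun w' s' b' c' y' hw' => ih w' (by omega) s' b' c' y'
        obtain ⟨e, he, hle⟩ := h w s b c y hne hIH
        refine le_trans (chord_nonneg_of_ends w e _ _ _ ?_ ?_) hle
        · refine hIH _ s b c y ?_
          have h1 := Finset.card_le_card (fracEdges_update_subset w e 0 (Or.inl rfl))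
          rw [Finset.card_erase_of_mem he] at h1
          have hpos := Finset.card_pos.2 hne
          omega
        · refine hIH _ s b c y ?_
          have h1 := Finset.card_le_card (fracEdges_update_subset w e 1 (Or.inr rfl))
          rw [Finset.card_erase_of_mem he] at h1
          have hpos := Finset.card_pos.2 hne
          omega

/-- **The increasing star follows from the mean-chord inequality** `#F(w)·E₃(w) ≥ Σ_{e∈F(w)} [(1 − w e)·E₃(w[e↦0]) + (w e)·E₃(w[e↦1])]`
(edge-averaged chord property; the induction hypothesis — the star for every weight with fewer fractional pairs and every marking — may be used
in verifying it). [this work] -/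
theorem incStar_nonneg_of_meanChord
    (h : ∀ (w : Sym2 (Fin n) → unitInterval) (s b c y : Fin n), (fracEdges w).Nonempty →
      (∀ (w' : Sym2 (Fin n) → unitInterval) (s' b' c' y' : Fin n), (fracEdges w').card < (fracEdges w).card →
          0 ≤ sahiE3 (prodBernoulli w') (openConn s' b') (openConn s' c') (openConn s' y')) →
      ∑ e ∈ fracEdges w, ((1 - (w e : ℝ)) * sahiE3 (prodBernoulli (Function.update w e 0)) (openConn s b) (openConn s c) (openConn s y)
          + (w e : ℝ) * sahiE3 (prodBernoulli (Function.update w e 1)) (openConn s b) (openConn s c) (openConn s y))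
        ≤ ((fracEdges w).card : ℝ) * sahiE3 (prodBernoulli w) (openConn s b) (openConn s c) (openConn s y)) :
    ∀ (w : Sym2 (Fin n) → unitInterval) (s b c y : Fin n),
      0 ≤ sahiE3 (prodBernoulli w) (openConn s b) (openConn s c) (openConn s y) :=
  incStar_nonneg_of_existsChord fun w s b c y hne hIH =>
    exists_le_of_sum_le_card_mul (fracEdges w) hne _ _ (h w s b c y hne hIH)

end IncStar

end Summit.CriticalPhenomena.PercolationContinuityZ3.Theorems
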